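import Literature.MathematicalPhysics.QuantumFieldTheory.Balaban1983to89.B8Eq138LandauFlatOrthogonal

/-!
# `Balaban1983to89.B8FlatBondCalculusZd` — flat bond-field calculus on `ℤᵈ` behind [Balaban1985RegularSpaces] (1.55)∕(1.59) at `U₀ = 1`:
# the energy identity `Σ φ̄·J(φ) = Σ_p |(D^η_1 φ)(p)|²` (`J = D^{η*}_1 D^η_1` IS the plaquette Laplacian `D*D`), the lattice Poincaré
# lemma with finite support (`D^η_1 φ = 0` on all plaquettes ⇒ `φ = D^η_1 λ`, `λ` supported in the box of `φ`, `d ≥ 2`), and the flat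
# iterated linear averages of a gradient at ALL levels (`L^jη·Q_j(1)(iη D^η_1λ) = i·L^{−jd}(Σ_{Bʲ(c₊)}λ − Σ_{Bʲ(c₋)}λ)`)

statement-level skeleton of published theorems with citation tags; proofs where landed; nothing here is a claim about the
Yang–Mills mass gap

`[Balaban1985RegularSpaces]` ("B8", CMP **99** (1985) 75–102) (1.1)–(1.2) p. 76, (1.38) p. 82, (1.55) p. 86, (1.58)–(1.59) p. 86;
`[Balaban1985BackgroundPropagators]` ("[4]", CMP **99** (1985) 389–434) (3.4) p. 391, (3.9)–(3.10) p. 392 («⟨A, ΔA⟩ = ⟨A, D*DA⟩ + ⟨A, Δ′A⟩»),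
(3.23)–(3.25) p. 394; `[Balaban1984PropagatorsII]` ("B6", CMP **96** (1984) 223–250) (2.11) p. 225 («the Laplace operator Δ is positive on
the subspace N(Q′), hence it is invertible on this subspace»); `[Balaban1985Averaging]` ("B7", CMP **98** (1985) 17–51) (122) + (125) p. 36,
(127) p. 37.

CITATION HEADER (lean-in-tree rule).  Cell `pub-ymgap` (YM Track A, HUMAN RULING D-0062 ∕ D-0149), DAG node N05 = [B8], width seat
`pub-ymgap-dag-n05-w3` (g0), CLAIM-2 ∕ INTENT-1 (bus 2026-08-27 22:52Z).  WHY: dag-n05-c g11 typed the REPAIRED flat (1.59) target of N05's cube road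
over print's constraint-bond class (`B8Ineq159FlatCubeMemberPrinted.cubeLamBP` ∕ `Ineq159FlatCubeMemberPrinted`, p573921) after certifying that the
typed class `cubeLamB` admits shell zero-modes (p572834), and certified that those particular modes carry a non-zero datum on the repaired class (p578369).
The sequel `B8Ineq159FlatCubeMemberKernel` proves that the repaired data admit NO zero mode at all (kernel zero at every cube member); this file
supplies the three pieces of flat lattice calculus on `ℤᵈ` it needs, member-independent — n05-c's `TRANSPLANT-DESIGN.md` T1 identities among them.

THE MATHEMATICS (kernel-checked; flat background `U₀ = 1`, `Site d = ℤᵈ`, `finsum` over finitely supported functions).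
* §1 ★ `finsum_conj_mul_covDeriv` — `D^{η*}_{1,ν}` (`B8Ineq132.covDeriv`) IS the `ℓ²`-adjoint of `D^η_{1,ν}` (`covDerivFwd`):
  `Σ_x \overline{f(x)}·(D^{η*}_ν g)(x) = Σ_x \overline{(D^η_ν f)(x)}·g(x)`; ★★ `sum_finsum_conj_mul_Jcur` — THE ENERGY IDENTITY
  `Σ_τ Σ_x \overline{φ_τ(x)}·J_τ(x) = Σ_{ν<τ} Σ_x |(D^η_1φ)_{ντ}(x)|²` for `J = pdiv ∘ plaqCovDeriv` (`B8Eq155JBound.Jcur`, (1.55)'s `D^{η*}_{U₀}D^η_{U₀}A`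
  at `U₀ = 1`); ★ `plaqCovDeriv_eq_zero_of_conj_mul_Jcur_eq_zero` — if `\overline{φ_τ(x)}·J_τ(x) = 0` at every bond then `D^η_1φ ≡ 0` (CLOSED).
* §2 ★★ `exists_eq_covDerivFwd_of_plaqCovDeriv_eq_zero` — THE LATTICE POINCARÉ LEMMA WITH FINITE SUPPORT (`d ≥ 2`, `η ≠ 0`): a closed bond field
  vanishing on every bond not touching the box `[lo, hi]` is `D^η_1λ` for a (unique) `λ : ℤᵈ → ℂ` supported in `[lo, hi]` — `λ(x) =
  −η·Σ_{t ≥ 0} φ₀(x + t e₀)`; the full line sums `Σ_{t∈ℤ} φ₀(x + te₀)` vanish (they are invariant under the transverse translations by closedness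
  and zero far away — this is where `d ≥ 2` enters).
* §3 ★ `linCovIter_one_grad` — at `U₀ = 1` the un-normalised iterated linear average (B7 (122)∕(127), `B7Prop4GeneralLevels.linCovIter`) of the
  field `iη·D^η_1λ` at level `j` is `i·L^{−jd}·(Σ_{x∈Bʲ(z+e_κ)}λ(x) − Σ_{x∈Bʲ(z)}λ(x))` (`Bʲ(z) = blockSites (L^j) z`) — all levels, generalising
  dag-n05-c's `B8SockB9P3ShellModeVacuityUniv.linCovIter_one_grad_level_one`.

HONEST SCOPE.  Elementary lattice calculus (summation by parts, telescoping, block nesting); nothing of Bałaban's analysis asserted; no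
estimate with constants; count-neutral; N05 NOT discharged; one finite `T⁴` programme at fixed `ε`, Bałaban as printed; the YM mass gap (Clay) is
NOT proved by any of this — R4 closes the conditional finite-`𝕋⁴` rung `BalabanLadder.UV` only; nothing continuum ∕ ℝ⁴ ∕ OS.  No `sorry`, no
`def`, no `instance`, no `notation`.  Unit `pub-ymgap-dag-n05-w3` (g0), 2026-08-27.
-/

noncomputable section

open ComplexConjugate

namespace Literature.MathematicalPhysics.QuantumFieldTheory.Balaban1983to89.B8FlatBondCalculusZd

open B7Prop1Explicit B7Prop2Explicit B7Prop1Local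
open B7Prop4GeneralLevels (linCovIter linCovIter_zero linCovIter_succ)
open B7Prop3GeneralLinear (linQcov_one_left)
open B7Prop3Flat (linQ)
open B8Ineq132 (covDerivFwd covDeriv BondTouches)
open B8Eq143PlaqExpansion (pdiv)
open B8Eq146AExpansion (iEta plaqCovDeriv plaqCovDeriv_eq_covDerivFwd)
open B8Eq155JBound (Jcur)
open B8Eq138LandauZd (covLap covDivB)
open B8Eq191FlatStencils (covDerivFwd_flat_apply covDeriv_flat_apply)
open Literature.MathematicalPhysics.QuantumLattice (blockMap blockSites mem_blockSites_iff)

export B7Prop1Explicit (Site)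

variable {d : ℕ}

/-! ## §0 Bookkeeping: shifts, supports, `finsum`s with a finitely supported factor -/

/-- Translation invariance of `finsum` on `ℤᵈ`: `Σ_x F(x + t) = Σ_x F(x)`. [folklore] -/
private theorem finsum_shift (t : Site d) (F : Site d → ℂ) : ∑ᶠ x, F (x + t) = ∑ᶠ x, F x :=
  finsum_comp_equiv (Equiv.addRight t) (f := F)

/-- A `finsum` with a left factor `u x` is a finite sum over any finset containing the support of `u`. [folklore] -/
private theorem finsum_mul_left_eq_sum {u : Site d → ℂ} {s : Finset (Site d)} (hs : Function.support u ⊆ ↑s) (G : Site d → ℂ) :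
    ∑ᶠ x, u x * G x = ∑ x ∈ s, u x * G x := by
  refine finsum_eq_sum_of_support_subset _ fun x hx => hs ?_
  rw [Function.mem_support] at hx ⊢
  intro h; apply hx; rw [h, zero_mul]

/-- A `finsum` with a right factor `v x` is a finite sum over any finset containing the support of `v`. [folklore] -/
private theorem finsum_mul_right_eq_sum {v : Site d → ℂ} {s : Finset (Site d)} (hs : Function.support v ⊆ ↑s) (G : Site d → ℂ) :
    ∑ᶠ x, G x * v x = ∑ x ∈ s, G x * v x := by
  refine finsum_eq_sum_of_support_subset _ fun x hx => hs ?_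
  rw [Function.mem_support] at hx ⊢
  intro h; apply hx; rw [h, mul_zero]

/-- The support of `x ↦ \overline{u(x)}` is the support of `u`. [folklore] -/
private theorem support_conj (u : Site d → ℂ) : Function.support (fun x => conj (u x)) = Function.support u := by
  ext x; simp [Function.mem_support]

/-- A shift `x ↦ f(x + t)` of a finitely supported function is finitely supported. [folklore] -/
private theorem support_shift_finite {f : Site d → ℂ} (hf : (Function.support f).Finite) (t : Site d) :
    (Function.support fun x => f (x + t)).Finite := by
  refine (hf.image fun x => x - t).subset fun x hx => ?_
  rw [Function.mem_support] at hx
  exact ⟨x + t, hx, by abel⟩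

/-- The flat forward derivative of a finitely supported function is finitely supported. [cite: Balaban1985RegularSpaces, (1.1) p.76] -/
theorem support_covDerivFwd_finite (η : ℝ) (μ : Fin d) {f : Site d → ℂ} (hf : (Function.support f).Finite) :
    (Function.support (covDerivFwd η (1 : Site d → Fin d → ℂˣ) μ f)).Finite := by
  refine (hf.union (support_shift_finite hf (e μ))).subset fun x hx => ?_
  rw [Function.mem_support, covDerivFwd_flat_apply] at hx
  by_contra h
  simp only [Set.mem_union, Function.mem_support, not_or, not_not] at h
  exact hx (by rw [h.1, h.2, sub_zero, smul_zero])

/-- The flat backward derivative of a finitely supported function is finitely supported. [cite: Balaban1985RegularSpaces, (1.1) p.76] -/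
theorem support_covDeriv_finite (η : ℝ) (ν : Fin d) {f : Site d → ℂ} (hf : (Function.support f).Finite) :
    (Function.support (covDeriv η (1 : Site d → Fin d → ℂˣ) ν f)).Finite := by
  refine (hf.union (support_shift_finite hf (-(e ν)))).subset fun x hx => ?_
  rw [Function.mem_support, covDeriv_flat_apply] at hx
  by_contra h
  simp only [Set.mem_union, Function.mem_support, not_or, not_not, ← sub_eq_add_neg] at h
  exact hx (by rw [h.1, h.2, sub_zero, smul_zero])

/-- The flat plaquette derivative of a componentwise finitely supported bond field is finitely supported. [cite: Balaban1985BackgroundPropagators, (3.4) p.391] -/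
theorem support_plaqCovDeriv_finite (η : ℝ) {φ : Site d → Fin d → ℂ} (hφ : ∀ τ, (Function.support fun x => φ x τ).Finite)
    (μ ν : Fin d) : (Function.support fun x => plaqCovDeriv η (1 : Site d → Fin d → ℂˣ) φ μ ν x).Finite := by
  refine ((support_covDerivFwd_finite η μ (hφ ν)).union (support_covDerivFwd_finite η ν (hφ μ))).subset fun x hx => ?_
  rw [Function.mem_support, plaqCovDeriv_eq_covDerivFwd] at hx
  by_contra h
  simp only [Set.mem_union, Function.mem_support, not_or, not_not] at h
  exact hx (by rw [h.1, h.2, sub_zero])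

/-! ## §1 `D^{η*}_1` is the adjoint of `D^η_1`; the energy identity for `J = D^{η*}_1D^η_1` -/

/-- ★ **`D^{η*}_{1,ν}` IS THE `ℓ²(ℤᵈ)`-ADJOINT OF `D^η_{1,ν}`** on finitely supported functions: `Σ_x \overline{f(x)}(D^{η*}_ν g)(x) =
Σ_x \overline{(D^η_ν f)(x)} g(x)` ((1.1): `(D^η_ν f)(x) = η⁻¹(f(x+e_ν) − f(x))`, `(D^{η*}_ν g)(x) = η⁻¹(g(x−e_ν) − g(x))`; translation invariance).
[cite: Balaban1985RegularSpaces, (1.1) p.76; Balaban1985BackgroundPropagators, (3.9) p.392] -/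
theorem finsum_conj_mul_covDeriv (η : ℝ) (ν : Fin d) {f g : Site d → ℂ} (hf : (Function.support f).Finite)
    (hg : (Function.support g).Finite) :
    ∑ᶠ x, conj (f x) * covDeriv η (1 : Site d → Fin d → ℂˣ) ν g x =
      ∑ᶠ x, conj (covDerivFwd η (1 : Site d → Fin d → ℂˣ) ν f x) * g x := by
  classical
  -- one finset carrying every support in sight
  set s : Finset (Site d) := hf.toFinset ∪ (support_shift_finite hf (e ν)).toFinset ∪ hg.toFinset ∪
    (support_shift_finite hg (-(e ν))).toFinset with hs
  have h1 : Function.support f ⊆ ↑s := fun x hx => by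
    rw [hs]; simp only [Finset.coe_union, Set.Finite.coe_toFinset]; exact Or.inl (Or.inl (Or.inl hx))
  have h2 : (Function.support fun x => f (x + e ν)) ⊆ ↑s := fun x hx => by
    rw [hs]; simp only [Finset.coe_union, Set.Finite.coe_toFinset]; exact Or.inl (Or.inl (Or.inr hx))
  have h3 : Function.support g ⊆ ↑s := fun x hx => by
    rw [hs]; simp only [Finset.coe_union, Set.Finite.coe_toFinset]; exact Or.inl (Or.inr hx)
  have h4 : (Function.support fun x => g (x + -e ν)) ⊆ ↑s := fun x hx => by
    rw [hs]; simp only [Finset.coe_union, Set.Finite.coe_toFinset]; exact Or.inr hx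
  have h1c : (Function.support fun x => conj (f x)) ⊆ ↑s := by rw [support_conj]; exact h1
  have h2c : (Function.support fun x => conj (f (x + e ν))) ⊆ ↑s := by
    rw [support_conj (fun x => f (x + e ν))]; exact h2
  -- the shift `Σ \overline{f(x+e)} g(x) = Σ \overline{f(x)} g(x−e)`
  have hshift : ∑ᶠ x, conj (f (x + e ν)) * g x = ∑ᶠ x, conj (f x) * g (x - e ν) := by
    rw [← finsum_shift (e ν) (fun x => conj (f x) * g (x - e ν))]
    simp only [add_sub_cancel_right]
  -- expand both sides over `s`
  have hL : ∑ᶠ x, conj (f x) * covDeriv η (1 : Site d → Fin d → ℂˣ) ν g x =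
      (η⁻¹ : ℂ) * (∑ᶠ x, conj (f x) * g (x - e ν) - ∑ᶠ x, conj (f x) * g x) := by
    rw [finsum_mul_left_eq_sum h1c, finsum_mul_left_eq_sum h1c, finsum_mul_left_eq_sum h1c, ← Finset.sum_sub_distrib,
      Finset.mul_sum]
    refine Finset.sum_congr rfl fun x _ => ?_
    rw [covDeriv_flat_apply, Complex.real_smul]
    push_cast
    ring
  have hR : ∑ᶠ x, conj (covDerivFwd η (1 : Site d → Fin d → ℂˣ) ν f x) * g x =
      (η⁻¹ : ℂ) * (∑ᶠ x, conj (f (x + e ν)) * g x - ∑ᶠ x, conj (f x) * g x) := by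
    rw [finsum_mul_right_eq_sum h3, finsum_mul_right_eq_sum h3 (fun x => conj (f (x + e ν))),
      finsum_mul_right_eq_sum h3 (fun x => conj (f x)), ← Finset.sum_sub_distrib, Finset.mul_sum]
    refine Finset.sum_congr rfl fun x _ => ?_
    rw [covDerivFwd_flat_apply, Complex.real_smul, map_mul, map_sub]
    simp only [Complex.conj_ofReal]
    push_cast
    ring
  rw [hL, hR, hshift]

/-- ★★ **THE ENERGY IDENTITY FOR `J = D^{η*}_1 D^η_1`** ([4] (3.10) «⟨A, ΔA⟩ = ⟨A, D*DA⟩ + …» at `U₀ = 1`, (1.55)'s current at the flat background):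
for a componentwise finitely supported bond field `φ`,
`Σ_τ Σ_x \overline{φ_τ(x)}·J_τ(x) = Σ_τ Σ_{ν<τ} Σ_x |(D^η_1φ)_{ντ}(x)|²`, where `J = B8Eq155JBound.Jcur η 1 φ = pdiv (plaqCovDeriv φ)` — the
divergence (1.2) of the plaquette derivative (3.4) IS the adjoint pairing `D*D` (plaquettes indexed once, `ν < τ`).
[cite: Balaban1985BackgroundPropagators, (3.9)–(3.10) p.392, (3.4) p.391; Balaban1985RegularSpaces, (1.2) p.76, (1.55) p.86] -/
theorem sum_finsum_conj_mul_Jcur (η : ℝ) {φ : Site d → Fin d → ℂ} (hφ : ∀ τ, (Function.support fun x => φ x τ).Finite) :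
    ∑ τ : Fin d, ∑ᶠ x, conj (φ x τ) * Jcur η (1 : Site d → Fin d → ℂˣ) φ τ x =
      ∑ τ : Fin d, ∑ ν ∈ Finset.Iio τ, ∑ᶠ x, conj (plaqCovDeriv η (1 : Site d → Fin d → ℂˣ) φ ν τ x) *
        plaqCovDeriv η (1 : Site d → Fin d → ℂˣ) φ ν τ x := by
  classical
  -- fold the plaquette derivative into a letter `F`
  obtain ⟨F, hF⟩ : ∃ F : Fin d → Fin d → Site d → ℂ,
      ∀ μ ν x, plaqCovDeriv η (1 : Site d → Fin d → ℂˣ) φ μ ν x = F μ ν x := ⟨_, fun _ _ _ => rfl⟩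
  have hFfin : ∀ μ ν, (Function.support (F μ ν)).Finite := fun μ ν => by
    have := support_plaqCovDeriv_finite η hφ μ ν
    simp_rw [hF] at this
    exact this
  have hFexp : ∀ μ ν x, F μ ν x = covDerivFwd η (1 : Site d → Fin d → ℂˣ) μ (fun y => φ y ν) x -
      covDerivFwd η (1 : Site d → Fin d → ℂˣ) ν (fun y => φ y μ) x := fun μ ν x => by
    rw [← hF, plaqCovDeriv_eq_covDerivFwd]
  have hJ : ∀ τ x, Jcur η (1 : Site d → Fin d → ℂˣ) φ τ x =
      ∑ ν ∈ Finset.Iio τ, covDeriv η (1 : Site d → Fin d → ℂˣ) ν (F ν τ) x -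
      ∑ ν ∈ Finset.Ioi τ, covDeriv η (1 : Site d → Fin d → ℂˣ) ν (F τ ν) x := by
    intro τ x
    rw [B8Eq155JBound.Jcur_def, pdiv]
    have h1 : ∀ a b, plaqCovDeriv η (1 : Site d → Fin d → ℂˣ) φ a b = F a b := fun a b => funext fun x => hF a b x
    simp_rw [h1]
  simp_rw [hF, hJ]
  -- Step 1: move `D^{η*}_ν` across: `Σ_x φ̄_τ J_τ = Σ_{ν<τ} Σ_x \overline{∂_νφ_τ} F_{ντ} − Σ_{ν>τ} Σ_x \overline{∂_νφ_τ} F_{τν}`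
  have hstep : ∀ τ : Fin d, ∑ᶠ x, conj (φ x τ) *
      (∑ ν ∈ Finset.Iio τ, covDeriv η (1 : Site d → Fin d → ℂˣ) ν (F ν τ) x -
        ∑ ν ∈ Finset.Ioi τ, covDeriv η (1 : Site d → Fin d → ℂˣ) ν (F τ ν) x) =
      ∑ ν ∈ Finset.Iio τ, ∑ᶠ x, conj (covDerivFwd η (1 : Site d → Fin d → ℂˣ) ν (fun y => φ y τ) x) * F ν τ x -
      ∑ ν ∈ Finset.Ioi τ, ∑ᶠ x, conj (covDerivFwd η (1 : Site d → Fin d → ℂˣ) ν (fun y => φ y τ) x) * F τ ν x := by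
    intro τ
    have hsc : (Function.support fun x => conj (φ x τ)) ⊆ ↑(hφ τ).toFinset := by
      rw [support_conj (fun x => φ x τ), Set.Finite.coe_toFinset]
    rw [finsum_mul_left_eq_sum hsc]
    simp only [mul_sub, Finset.mul_sum, Finset.sum_sub_distrib]
    rw [Finset.sum_comm, Finset.sum_comm (s := (hφ τ).toFinset) (t := Finset.Ioi τ)]
    congr 1
    · refine Finset.sum_congr rfl fun ν _ => ?_
      rw [← finsum_mul_left_eq_sum hsc, finsum_conj_mul_covDeriv η ν (hφ τ) (hFfin ν τ)]
    · refine Finset.sum_congr rfl fun ν _ => ?_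
      rw [← finsum_mul_left_eq_sum hsc, finsum_conj_mul_covDeriv η ν (hφ τ) (hFfin τ ν)]
  -- Step 2: the right side, expanded: `Σ_x F̄_{ντ}F_{ντ} = Σ_x \overline{∂_νφ_τ}F_{ντ} − Σ_x \overline{∂_τφ_ν}F_{ντ}`
  have hsq : ∀ ν τ : Fin d, ∑ᶠ x, conj (F ν τ x) * F ν τ x =
      ∑ᶠ x, conj (covDerivFwd η (1 : Site d → Fin d → ℂˣ) ν (fun y => φ y τ) x) * F ν τ x -
      ∑ᶠ x, conj (covDerivFwd η (1 : Site d → Fin d → ℂˣ) τ (fun y => φ y ν) x) * F ν τ x := by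
    intro ν τ
    have hS : Function.support (F ν τ) ⊆ ↑(hFfin ν τ).toFinset := by rw [Set.Finite.coe_toFinset]
    rw [finsum_mul_right_eq_sum hS, finsum_mul_right_eq_sum hS (fun x => conj (covDerivFwd η _ ν (fun y => φ y τ) x)),
      finsum_mul_right_eq_sum hS (fun x => conj (covDerivFwd η _ τ (fun y => φ y ν) x)), ← Finset.sum_sub_distrib]
    refine Finset.sum_congr rfl fun x _ => ?_
    rw [← sub_mul, ← map_sub, ← hFexp]
  -- Step 3: reindex the `ν > τ` block as pairs `τ' < ν'`
  have hswap : ∑ τ : Fin d, ∑ ν ∈ Finset.Ioi τ,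
      ∑ᶠ x, conj (covDerivFwd η (1 : Site d → Fin d → ℂˣ) ν (fun y => φ y τ) x) * F τ ν x =
      ∑ τ : Fin d, ∑ ν ∈ Finset.Iio τ,
      ∑ᶠ x, conj (covDerivFwd η (1 : Site d → Fin d → ℂˣ) τ (fun y => φ y ν) x) * F ν τ x := by
    rw [Finset.sum_sigma' Finset.univ (fun τ => Finset.Ioi τ), Finset.sum_sigma' Finset.univ (fun τ => Finset.Iio τ)]
    refine Finset.sum_bij' (fun p _ => ⟨p.2, p.1⟩) (fun p _ => ⟨p.2, p.1⟩) ?_ ?_ ?_ ?_ ?_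
    · rintro ⟨τ, ν⟩ hp
      simp only [Finset.mem_sigma, Finset.mem_univ, Finset.mem_Ioi, true_and] at hp
      simp only [Finset.mem_sigma, Finset.mem_univ, Finset.mem_Iio, true_and]
      exact hp
    · rintro ⟨τ, ν⟩ hp
      simp only [Finset.mem_sigma, Finset.mem_univ, Finset.mem_Iio, true_and] at hp
      simp only [Finset.mem_sigma, Finset.mem_univ, Finset.mem_Ioi, true_and]
      exact hp
    · rintro ⟨τ, ν⟩ _; rfl
    · rintro ⟨τ, ν⟩ _; rfl
    · rintro ⟨τ, ν⟩ _; rfl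
  simp_rw [hstep, hsq]
  simp only [Finset.sum_sub_distrib]
  rw [hswap]

/-- ★ **A BOND FIELD WITH `\overline{φ_τ}·J_τ ≡ 0` IS CLOSED**: if at every bond `\overline{φ_τ(x)}·J_τ(x) = 0` (e.g. `J = 0` wherever `φ ≠ 0`),
then `(D^η_1φ)(p) = 0` at every plaquette (energy identity + positivity). [cite: Balaban1985BackgroundPropagators, (3.9)–(3.10) p.392; Balaban1984PropagatorsII, (2.11) p.225] -/
theorem plaqCovDeriv_eq_zero_of_conj_mul_Jcur_eq_zero (η : ℝ) {φ : Site d → Fin d → ℂ}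
    (hφ : ∀ τ, (Function.support fun x => φ x τ).Finite)
    (hJ : ∀ x τ, conj (φ x τ) * Jcur η (1 : Site d → Fin d → ℂˣ) φ τ x = 0) (μ ν : Fin d) (x : Site d) :
    plaqCovDeriv η (1 : Site d → Fin d → ℂˣ) φ μ ν x = 0 := by
  classical
  have hFfin : ∀ μ ν, (Function.support fun x => plaqCovDeriv η (1 : Site d → Fin d → ℂˣ) φ μ ν x).Finite :=
    fun μ ν => support_plaqCovDeriv_finite η hφ μ ν
  have hFanti : ∀ μ ν x, plaqCovDeriv η (1 : Site d → Fin d → ℂˣ) φ ν μ x = -plaqCovDeriv η (1 : Site d → Fin d → ℂˣ) φ μ ν x := by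
    intro μ ν x
    simp only [plaqCovDeriv_eq_covDerivFwd]
    ring
  have h0 : ∑ τ : Fin d, ∑ᶠ x, conj (φ x τ) * Jcur η (1 : Site d → Fin d → ℂˣ) φ τ x = 0 := by
    refine Finset.sum_eq_zero fun τ _ => ?_
    simp_rw [hJ]
    exact finsum_zero
  rw [sum_finsum_conj_mul_Jcur η hφ] at h0
  -- every term is a non-negative real; the total vanishes
  have hterm : ∀ ν τ : Fin d, ∑ᶠ x, conj (plaqCovDeriv η (1 : Site d → Fin d → ℂˣ) φ ν τ x) *
      plaqCovDeriv η (1 : Site d → Fin d → ℂˣ) φ ν τ x =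
      ((∑ x ∈ (hFfin ν τ).toFinset, ‖plaqCovDeriv η (1 : Site d → Fin d → ℂˣ) φ ν τ x‖ ^ 2 : ℝ) : ℂ) :=
    fun ν τ => B8Ineq159FlatShellModeCrossingDatum.finsum_conj_mul_self_eq (hFfin ν τ)
  simp_rw [hterm] at h0
  have h0' : ∑ τ : Fin d, ∑ ν ∈ Finset.Iio τ, ∑ x ∈ (hFfin ν τ).toFinset,
      ‖plaqCovDeriv η (1 : Site d → Fin d → ℂˣ) φ ν τ x‖ ^ 2 = 0 := by exact_mod_cast h0
  have hall := (Finset.sum_eq_zero_iff_of_nonneg fun τ _ =>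
    Finset.sum_nonneg fun ν _ => Finset.sum_nonneg fun x _ => sq_nonneg _).1 h0'
  have hlt : ∀ ν τ : Fin d, ν < τ → ∀ x, plaqCovDeriv η (1 : Site d → Fin d → ℂˣ) φ ν τ x = 0 := by
    intro ν τ hντ
    have h1 := (Finset.sum_eq_zero_iff_of_nonneg fun ν _ => Finset.sum_nonneg fun x _ => sq_nonneg _).1
      (hall τ (Finset.mem_univ τ)) ν (Finset.mem_Iio.2 hντ)
    have hz := B8Ineq159FlatShellModeCrossingDatum.eq_zero_of_finsum_conj_mul_self_eq_zero (hFfin ν τ)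
      (by rw [hterm ν τ]; exact_mod_cast h1)
    exact fun x => congrFun hz x
  rcases lt_trichotomy μ ν with h | rfl | h
  · exact hlt μ ν h x
  · simp only [plaqCovDeriv_eq_covDerivFwd, sub_self]
  · rw [hFanti ν μ x, hlt ν μ h x, neg_zero]

/-! ## §2 The lattice Poincaré lemma with finite support on `ℤᵈ`, `d ≥ 2` -/

/-- A point with one coordinate above the box is outside the box (bookkeeping for the boxes `□_j^{(j)}` of (1.131)). [folklore] [cite: Balaban1985RegularSpaces, (1.131) p.99, p.77 (bond convention)] -/
theorem not_inBox_of_hi_lt {lo hi y : Site d} {i : Fin d} (h : hi i < y i) : ¬ InBox lo hi y :=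
  fun hy => absurd (hy i).2 (not_le.2 h)

/-- A point with one coordinate below the box is outside the box (bookkeeping for the boxes `□_j^{(j)}` of (1.131)). [folklore] [cite: Balaban1985RegularSpaces, (1.131) p.99, p.77 (bond convention)] -/
theorem not_inBox_of_lt_lo {lo hi y : Site d} {i : Fin d} (h : y i < lo i) : ¬ InBox lo hi y :=
  fun hy => absurd (hy i).1 (not_le.2 h)

/-- **Closedness in coordinates**: `D^η_1φ ≡ 0` means `φ_ν(x + e_μ) − φ_ν(x) = φ_μ(x + e_ν) − φ_μ(x)` (`η ≠ 0`). [cite: Balaban1985BackgroundPropagators, (3.4) p.391] -/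
theorem sub_eq_sub_of_plaqCovDeriv_eq_zero {η : ℝ} (hη : η ≠ 0) {φ : Site d → Fin d → ℂ}
    (hF : ∀ μ ν x, plaqCovDeriv η (1 : Site d → Fin d → ℂˣ) φ μ ν x = 0) (μ ν : Fin d) (x : Site d) :
    φ (x + e μ) ν - φ x ν = φ (x + e ν) μ - φ x μ := by
  have h := hF μ ν x
  rw [plaqCovDeriv_eq_covDerivFwd, covDerivFwd_flat_apply, covDerivFwd_flat_apply, sub_eq_zero] at h
  have hη' : (η⁻¹ : ℝ) ≠ 0 := inv_ne_zero hη
  exact smul_right_injective _ hη' h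

/-- **Telescoping a closed field along a ray**: `Σ_{t<n} (φ₀(x + e_κ + te₀) − φ₀(x + te₀)) = φ_κ(x + ne₀) − φ_κ(x)` for a closed `φ`
(each summand is `φ_κ(x + (t+1)e₀) − φ_κ(x + te₀)`). [cite: Balaban1985BackgroundPropagators, (3.4) p.391] -/
theorem sum_range_transverse_diff_eq {η : ℝ} (hη : η ≠ 0) {φ : Site d → Fin d → ℂ}
    (hF : ∀ μ ν x, plaqCovDeriv η (1 : Site d → Fin d → ℂˣ) φ μ ν x = 0) (i₀ κ : Fin d) (x : Site d) (n : ℕ) :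
    ∑ t ∈ Finset.range n, (φ (x + (t : ℤ) • e i₀ + e κ) i₀ - φ (x + (t : ℤ) • e i₀) i₀) =
      φ (x + (n : ℤ) • e i₀) κ - φ x κ := by
  have hterm : ∀ t : ℕ, φ (x + (t : ℤ) • e i₀ + e κ) i₀ - φ (x + (t : ℤ) • e i₀) i₀ =
      φ (x + ((t + 1 : ℕ) : ℤ) • e i₀) κ - φ (x + (t : ℤ) • e i₀) κ := by
    intro t
    rw [sub_eq_sub_of_plaqCovDeriv_eq_zero hη hF κ i₀]
    congr 2
    push_cast; rw [add_smul, one_smul, add_assoc]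
  simp_rw [hterm]
  rw [Finset.sum_range_sub (fun t : ℕ => φ (x + (t : ℤ) • e i₀) κ) n]
  simp

/-- ★★ **THE LATTICE POINCARÉ LEMMA WITH FINITE SUPPORT** (`d ≥ 2`, `η ≠ 0`): a bond field `φ` on `ℤᵈ` that vanishes on every bond not touching the
box `[lo, hi]` and is CLOSED (`(D^η_1φ)(p) = 0` at every plaquette, [4] (3.4)) is a flat gradient, `φ_κ(x) = (D^η_{1,κ}λ)(x) = η⁻¹(λ(x + e_κ) − λ(x))`,
of a site function `λ` SUPPORTED IN THE BOX — namely `λ(x) = −η·Σ_{t ≥ 0} φ₀(x + te₀)`.  The transverse derivatives come out right by closedness and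
telescoping; `λ` vanishes below the box in the `e₀` direction because every full line sum `Σ_{t∈ℤ} φ₀(x + te₀)` vanishes (it is invariant under the
transverse translations — closedness again — and zero far away in a transverse direction, which exists as `d ≥ 2`).
[cite: Balaban1985BackgroundPropagators, (3.4) p.391, (3.9)–(3.10) p.392; Balaban1984PropagatorsII, (2.11) p.225] -/
theorem exists_eq_covDerivFwd_of_plaqCovDeriv_eq_zero (hd : 2 ≤ d) {η : ℝ} (hη : η ≠ 0) (lo hi : Site d)
    {φ : Site d → Fin d → ℂ} (hφ : ∀ x τ, ¬ BondTouches {y | InBox lo hi y} x τ → φ x τ = 0)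
    (hF : ∀ μ ν x, plaqCovDeriv η (1 : Site d → Fin d → ℂˣ) φ μ ν x = 0) :
    ∃ lam : Site d → ℂ, (∀ x κ, covDerivFwd η (1 : Site d → Fin d → ℂˣ) κ lam x = φ x κ) ∧
      (∀ x, ¬ InBox lo hi x → lam x = 0) := by
  classical
  set i₀ : Fin d := ⟨0, by omega⟩ with hi₀
  set i₁ : Fin d := ⟨1, by omega⟩ with hi₁
  have h01 : i₁ ≠ i₀ := by rw [hi₀, hi₁]; simp [Fin.ext_iff]
  -- `φ` vanishes on a bond whose two ends are outside the box
  have hout : ∀ y μ, ¬ InBox lo hi y → ¬ InBox lo hi (y + e μ) → φ y μ = 0 := fun y μ h1 h2 =>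
    hφ y μ (by rintro (h | h) <;> [exact h1 h; exact h2 h])
  -- the number of steps from `x` to the top of the box in direction `e₀`, and the candidate `λ`
  set N : Site d → ℕ := fun x => (hi i₀ + 1 - x i₀).toNat with hN
  set lam : Site d → ℂ := fun x => -(η : ℂ) * ∑ t ∈ Finset.range (N x), φ (x + (t : ℤ) • e i₀) i₀ with hlam
  -- coordinates along the ray
  have hray : ∀ (x : Site d) (t : ℤ) (i : Fin d), (x + t • e i₀) i = x i + (if i = i₀ then t else 0) :=
    fun x t i => add_zsmul_e_apply x t i₀ i
  -- transverse moves do not change `N`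
  have hNtrans : ∀ (x : Site d) (κ : Fin d), κ ≠ i₀ → N (x + e κ) = N x := by
    intro x κ hκ
    simp only [hN, add_e_apply, if_neg (Ne.symm hκ), add_zero]
  -- the endpoint `x + N(x)•e₀` is above the box, so `φ_κ` vanishes there
  have hend : ∀ (x : Site d) (κ : Fin d), φ (x + (N x : ℤ) • e i₀) κ = 0 := by
    intro x κ
    have hc : hi i₀ < (x + (N x : ℤ) • e i₀) i₀ := by
      rw [hray, if_pos rfl, hN]
      simp only [Int.toNat_eq_max]
      rcases le_or_gt (hi i₀ + 1 - x i₀) 0 with h | h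
      · rw [max_eq_right h]; omega
      · rw [max_eq_left h.le]; omega
    refine hout _ κ (not_inBox_of_hi_lt hc) (not_inBox_of_hi_lt (i := i₀) ?_)
    rw [add_e_apply]
    split_ifs <;> omega
  -- (P2) transverse derivatives: `λ(x + e_κ) − λ(x) = η·φ_κ(x)` for `κ ≠ e₀`
  have hP2 : ∀ (x : Site d) (κ : Fin d), κ ≠ i₀ → lam (x + e κ) - lam x = (η : ℂ) * φ x κ := by
    intro x κ hκ
    have hpt : ∀ t : ℕ, x + e κ + (t : ℤ) • e i₀ = x + (t : ℤ) • e i₀ + e κ := fun t => by abel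
    simp only [hlam]
    rw [hNtrans x κ hκ]
    simp_rw [hpt]
    rw [← sub_eq_zero]
    have := sum_range_transverse_diff_eq hη hF i₀ κ x (N x)
    rw [Finset.sum_sub_distrib, hend, zero_sub] at this
    -- `-η Σ φ₀(⋯ + e_κ) - (-η Σ φ₀(⋯)) - η φ_κ(x) = -η (Σ⋯ - Σ⋯) - η φ_κ(x) = -η(-φ_κ x) - η φ_κ x = 0`
    rw [show -(η : ℂ) * ∑ t ∈ Finset.range (N x), φ (x + (t : ℤ) • e i₀ + e κ) i₀ -
        -(η : ℂ) * ∑ t ∈ Finset.range (N x), φ (x + (t : ℤ) • e i₀) i₀ =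
        -(η : ℂ) * (∑ t ∈ Finset.range (N x), φ (x + (t : ℤ) • e i₀ + e κ) i₀ -
          ∑ t ∈ Finset.range (N x), φ (x + (t : ℤ) • e i₀) i₀) by ring, this]
    ring
  -- (P1) the derivative along `e₀`: `λ(x + e₀) − λ(x) = η·φ₀(x)`
  have hP1 : ∀ x : Site d, lam (x + e i₀) - lam x = (η : ℂ) * φ x i₀ := by
    intro x
    simp only [hlam]
    have hNs : N (x + e i₀) = (hi i₀ - x i₀).toNat := by
      simp only [hN, add_e_apply, if_true]
      congr 1; ring
    rcases le_or_gt (x i₀) (hi i₀) with hle | hlt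
    · -- inside (or below) in the `e₀` coordinate: `N x = N (x + e₀) + 1`
      have hNx : N x = (hi i₀ - x i₀).toNat + 1 := by
        simp only [hN]; omega
      rw [hNs, hNx, Finset.sum_range_succ']
      have hpt : ∀ t : ℕ, x + ((t + 1 : ℕ) : ℤ) • e i₀ = x + e i₀ + (t : ℤ) • e i₀ := fun t => by
        push_cast; rw [add_smul, one_smul]; abel
      simp_rw [hpt]
      simp only [Nat.cast_zero, zero_smul, add_zero]
      ring
    · -- above the box: both sums are empty and `φ₀(x) = 0`
      have hNx : N x = 0 := by simp only [hN]; exact Int.toNat_eq_zero.2 (by omega)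
      have hNs' : N (x + e i₀) = 0 := by rw [hNs]; exact Int.toNat_eq_zero.2 (by omega)
      rw [hNx, hNs']
      simp only [Finset.sum_range_zero, mul_zero, sub_self]
      rw [hout x i₀ (not_inBox_of_hi_lt hlt) (not_inBox_of_hi_lt (i := i₀) (by rw [add_e_apply, if_pos rfl]; omega)),
        mul_zero]
  -- FULL LINE SUMS VANISH: for `y` strictly below the box in the `e₀` coordinate, `Σ_{t<N(y)} φ₀(y + te₀) = 0`
  have hline : ∀ y : Site d, y i₀ < lo i₀ → ∑ t ∈ Finset.range (N y), φ (y + (t : ℤ) • e i₀) i₀ = 0 := by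
    -- transverse invariance
    have hinv : ∀ (y : Site d) (κ : Fin d), κ ≠ i₀ → y i₀ < lo i₀ →
        ∑ t ∈ Finset.range (N (y + e κ)), φ (y + e κ + (t : ℤ) • e i₀) i₀ =
          ∑ t ∈ Finset.range (N y), φ (y + (t : ℤ) • e i₀) i₀ := by
      intro y κ hκ hy
      have hpt : ∀ t : ℕ, y + e κ + (t : ℤ) • e i₀ = y + (t : ℤ) • e i₀ + e κ := fun t => by abel
      rw [hNtrans y κ hκ, ← sub_eq_zero, ← Finset.sum_sub_distrib]
      simp_rw [hpt]
      rw [sum_range_transverse_diff_eq hη hF i₀ κ y (N y), hend, zero_sub, neg_eq_zero]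
      refine hout y κ (not_inBox_of_lt_lo hy) (not_inBox_of_lt_lo (i := i₀) ?_)
      rw [add_e_apply, if_neg (Ne.symm hκ), add_zero]; exact hy
    -- iterate along `e₁`
    have hiter : ∀ (n : ℕ) (y : Site d), y i₀ < lo i₀ →
        ∑ t ∈ Finset.range (N (y + (n : ℤ) • e i₁)), φ (y + (n : ℤ) • e i₁ + (t : ℤ) • e i₀) i₀ =
          ∑ t ∈ Finset.range (N y), φ (y + (t : ℤ) • e i₀) i₀ := by
      intro n
      induction n with
      | zero => intro y _; simp
      | succ n ih =>
        intro y hy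
        have hy' : (y + (n : ℤ) • e i₁) i₀ < lo i₀ := by
          rw [add_zsmul_e_apply, if_neg h01.symm, add_zero]; exact hy
        have h1 := hinv (y + (n : ℤ) • e i₁) i₁ h01 hy'
        have hpt : y + ((n + 1 : ℕ) : ℤ) • e i₁ = y + (n : ℤ) • e i₁ + e i₁ := by
          push_cast; rw [add_smul, one_smul, add_assoc]
        rw [hpt, h1, ih y hy]
    -- far away along `e₁` every term vanishes
    intro y hy
    set n : ℕ := (hi i₁ + 1 - y i₁).toNat with hn
    rw [← hiter n y hy]
    refine Finset.sum_eq_zero fun t _ => ?_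
    have hc : hi i₁ < (y + (n : ℤ) • e i₁ + (t : ℤ) • e i₀) i₁ := by
      rw [hray, if_neg h01, add_zero, add_zsmul_e_apply, if_pos rfl, hn]
      simp only [Int.toNat_eq_max]
      rcases le_or_gt (hi i₁ + 1 - y i₁) 0 with h | h
      · rw [max_eq_right h]; omega
      · rw [max_eq_left h.le]; omega
    refine hout _ i₀ (not_inBox_of_hi_lt hc) (not_inBox_of_hi_lt (i := i₁) ?_)
    rw [add_e_apply, if_neg h01]; simpa using hc
  have hηC : (η : ℂ) ≠ 0 := Complex.ofReal_ne_zero.2 hη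
  refine ⟨lam, fun x κ => ?_, fun x hx => ?_⟩
  · -- the gradient
    rw [covDerivFwd_flat_apply]
    by_cases hκ : κ = i₀
    · subst hκ; rw [hP1 x, Complex.real_smul]; push_cast; rw [← mul_assoc, inv_mul_cancel₀ hηC, one_mul]
    · rw [hP2 x κ hκ, Complex.real_smul]; push_cast; rw [← mul_assoc, inv_mul_cancel₀ hηC, one_mul]
  · -- the support
    simp only [hlam]
    have hx' : ∃ i, x i < lo i ∨ hi i < x i := by
      by_contra h
      push Not at h
      exact hx fun i => ⟨(h i).1, (h i).2⟩
    obtain ⟨i, hci⟩ := hx'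
    by_cases hii : i = i₀
    · subst hii
      rcases hci with hlt | hgt
      · rw [hline x hlt, mul_zero]
      · have hNx : N x = 0 := by simp only [hN]; exact Int.toNat_eq_zero.2 (by omega)
        rw [hNx, Finset.sum_range_zero, mul_zero]
    · rw [Finset.sum_eq_zero fun t _ => ?_, mul_zero]
      have hc : ∀ s : ℤ, ¬ InBox lo hi (x + s • e i₀) := by
        intro s
        rcases hci with hlt | hgt
        · exact not_inBox_of_lt_lo (i := i) (by rw [hray, if_neg hii, add_zero]; exact hlt)
        · exact not_inBox_of_hi_lt (i := i) (by rw [hray, if_neg hii, add_zero]; exact hgt)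
      refine hout _ i₀ (hc t) ?_
      have : x + (t : ℤ) • e i₀ + e i₀ = x + ((t : ℤ) + 1) • e i₀ := by rw [add_smul, one_smul, add_assoc]
      rw [this]; exact hc _

/-! ## §3 The flat iterated linear averages of a gradient, all levels -/

/-- A block of side `1` is a point: `Σ_{x ∈ B¹(w)} g(x) = g(w)`. [cite: Balaban1985Averaging, (2) p.17] -/
theorem sum_blockSites_one {β : Type*} [AddCommMonoid β] (w : Site d) (g : Site d → β) :
    ∑ x ∈ blockSites 1 w, g x = g w := by
  rw [B7Eq214FlatQprime.sum_blockSites_eq_sum_boxVec]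
  rw [Fintype.sum_eq_single (fun _ => (0 : Fin 1))]
  · have h0 : boxVec 1 (fun _ : Fin d => (0 : Fin 1)) = (0 : Site d) := funext fun κ => by simp [boxVec]
    rw [h0, add_zero, Nat.cast_one, one_smul]
  · exact fun r hr => absurd (funext fun κ => Subsingleton.elim _ _) hr

/-- The block `B(y)` of side `N` has at most `Nᵈ` sites. [cite: Balaban1985Averaging, (2) p.17] -/
theorem card_blockSites_le (N : ℕ) (y : Site d) : (blockSites N y).card ≤ N ^ d := by
  classical
  unfold blockSites
  refine Finset.card_image_le.trans ?_
  rw [Fintype.card_piFinset]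
  simp

/-- A block sum over `B(y)` (side `N`, `Nᵈ` sites) of a bounded function is bounded by `Nᵈ` times the bound. [folklore] [cite: Balaban1985Averaging, (2) p.17] -/
theorem norm_sum_blockSites_le {N : ℕ} {lam : Site d → ℂ} {Λ : ℝ} (hΛ : ∀ x, ‖lam x‖ ≤ Λ) (y : Site d) :
    ‖∑ x ∈ blockSites N y, lam x‖ ≤ (N : ℝ) ^ d * Λ := by
  have hΛ0 : 0 ≤ Λ := (norm_nonneg _).trans (hΛ y)
  refine (norm_sum_le _ _).trans ?_
  refine (Finset.sum_le_card_nsmul _ _ Λ fun x _ => hΛ x).trans ?_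
  rw [nsmul_eq_mul]
  refine mul_le_mul_of_nonneg_right ?_ hΛ0
  exact_mod_cast card_blockSites_le N y

/-- ★ **THE FLAT ITERATED LINEAR AVERAGE OF A GRADIENT, ALL LEVELS**: at `U₀ = 1` (`Ū₀ʲ = 1`), for a bounded `λ : ℤᵈ → ℂ`, the un-normalised
`j`-fold composite «Lʲη·Q_j(1)» (B7 p. 38, `B7Prop4GeneralLevels.linCovIter`, each factor the linear part (122) `linQcov` = `linQ` at the flat
background) of the bond field `iη·D^η_1λ` is the gradient of the `Lʲ`-block mean:
`linCovIter L 1 (iη D^η_1λ) j (z, κ) = L^{−jd}·i·(Σ_{x∈Bʲ(z+e_κ)} λ(x) − Σ_{x∈Bʲ(z)} λ(x))`, `Bʲ(z) = blockSites (Lʲ) z` — by induction on `j`: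
telescoping of the straight contours `Σ_{i<L}` and the block nesting `B^{j+1}(w) = ⋃_{x′∈B(w)} Bʲ(x′)`.  Level one is dag-n05-c's
`B8SockB9P3ShellModeVacuityUniv.linCovIter_one_grad_level_one`. [cite: Balaban1985Averaging, (122) + (125) p.36, (127) p.37, p.38; Balaban1985RegularSpaces, (1.31) p.82] -/
theorem linCovIter_one_grad {L : ℕ} (hL : 1 ≤ L) {η : ℝ} (hη : 0 < η) {lam : Site d → ℂ} {Λ : ℝ}
    (hΛ : ∀ x, ‖lam x‖ ≤ Λ) :
    ∀ (j : ℕ) (z : Site d) (κ : Fin d),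
      linCovIter L (1 : Site d → Fin d → ℂˣ) (iEta η (fun y τ => covDerivFwd η (1 : Site d → Fin d → ℂˣ) τ lam y)) j z κ =
        (((L : ℝ) ^ (j * d))⁻¹ : ℝ) •
          (Complex.I * (∑ x ∈ blockSites (L ^ j) (z + e κ), lam x - ∑ x ∈ blockSites (L ^ j) z, lam x)) := by
  have hΛ0 : 0 ≤ Λ := (norm_nonneg _).trans (hΛ 0)
  have hηC : (η : ℂ) ≠ 0 := Complex.ofReal_ne_zero.2 hη.ne'
  have hL0 : (0 : ℝ) < (L : ℝ) := by exact_mod_cast hL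
  intro j
  induction j with
  | zero =>
    intro z κ
    rw [linCovIter_zero, zero_mul, pow_zero, inv_one, one_smul, pow_zero, sum_blockSites_one, sum_blockSites_one]
    simp only [B8Eq146AExpansion.iEta_def, covDerivFwd_flat_apply, Complex.real_smul, smul_eq_mul]
    push_cast
    rw [mul_assoc, ← mul_assoc (η : ℂ), mul_inv_cancel₀ hηC, one_mul]
  | succ j ih =>
    intro z κ
    -- the level-`j` field as an explicit function, and its bound
    set S : Site d → ℂ := fun w => ∑ x ∈ blockSites (L ^ j) w, lam x with hS
    have hB : linCovIter L (1 : Site d → Fin d → ℂˣ) (iEta η (fun y τ => covDerivFwd η (1 : Site d → Fin d → ℂˣ) τ lam y)) j =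
        fun w τ => (((L : ℝ) ^ (j * d))⁻¹ : ℝ) • (Complex.I * (S (w + e τ) - S w)) := by
      funext w τ; rw [ih w τ]
    have hSb : ∀ w, ‖S w‖ ≤ ((L ^ j : ℕ) : ℝ) ^ d * Λ := fun w => norm_sum_blockSites_le hΛ w
    have hbd : ∀ w τ, ‖(((L : ℝ) ^ (j * d))⁻¹ : ℝ) • (Complex.I * (S (w + e τ) - S w))‖ ≤
        ((L : ℝ) ^ (j * d))⁻¹ * ((((L ^ j : ℕ) : ℝ) ^ d * Λ) + (((L ^ j : ℕ) : ℝ) ^ d * Λ)) := by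
      intro w τ
      rw [norm_smul, Real.norm_of_nonneg (by positivity), norm_mul, Complex.norm_I, one_mul]
      exact mul_le_mul_of_nonneg_left ((norm_sub_le _ _).trans (add_le_add (hSb _) (hSb _))) (by positivity)
    rw [linCovIter_succ, B7Eq92Concrete.avgIter_one, hB, linQcov_one_left L hL _ (by positivity) hbd]
    -- unfold the one-step flat linear average and telescope along the straight contours
    simp only [linQ, asum_seg_natCast]
    have htel : ∀ p : Site d, ∑ i ∈ Finset.range L,
        (((L : ℝ) ^ (j * d))⁻¹ : ℝ) • (Complex.I * (S (p + (i : ℤ) • e κ + e κ) - S (p + (i : ℤ) • e κ))) =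
        (((L : ℝ) ^ (j * d))⁻¹ : ℝ) • (Complex.I * (S (p + (L : ℤ) • e κ) - S p)) := by
      intro p
      have hshift : ∀ i : ℕ, p + (i : ℤ) • e κ + e κ = p + ((i + 1 : ℕ) : ℤ) • e κ := by
        intro i; push_cast; rw [add_smul, one_smul, add_assoc]
      simp_rw [hshift]
      rw [← Finset.smul_sum, ← Finset.mul_sum, Finset.sum_range_sub (fun i : ℕ => S (p + (i : ℤ) • e κ)) L]
      simp
    simp_rw [htel]
    have hpt : ∀ r : Fin d → Fin L, (L : ℤ) • z + boxVec L r + (L : ℤ) • e κ = (L : ℤ) • (z + e κ) + boxVec L r := by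
      intro r; rw [smul_add]; abel
    simp_rw [hpt]
    -- block nesting
    have hnest : ∀ w : Site d, ∑ r : Fin d → Fin L, S ((L : ℤ) • w + boxVec L r) = ∑ x ∈ blockSites (L ^ (j + 1)) w, lam x := by
      intro w
      rw [← B7Eq214FlatQprime.sum_blockSites_eq_sum_boxVec L w S, hS, pow_succ,
        B7BlockGeometry.sum_blockSites_mul (L ^ j) L (by positivity) (by omega)]
    have hc : ((L : ℝ) ^ d)⁻¹ * ((L : ℝ) ^ (j * d))⁻¹ = ((L : ℝ) ^ ((j + 1) * d))⁻¹ := by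
      rw [Nat.succ_mul, pow_add, mul_inv, mul_comm]
    simp only [smul_sub, mul_sub, Finset.sum_sub_distrib, ← Finset.smul_sum, ← Finset.mul_sum, smul_smul, hnest, hc]

#print axioms sum_finsum_conj_mul_Jcur
#print axioms plaqCovDeriv_eq_zero_of_conj_mul_Jcur_eq_zero
#print axioms exists_eq_covDerivFwd_of_plaqCovDeriv_eq_zero
#print axioms linCovIter_one_grad

end Literature.MathematicalPhysics.QuantumFieldTheory.Balaban1983to89.B8FlatBondCalculusZd

end
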